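import Summits.ValiantsHypothesis.ValiantsHypothesis.Theorems.BarrierLeverAnchoredDoorHitsLowerPairsTropical

/-!
# Support item `AnchoredDoorHitsLowerPairs` (stmt-ValiantsHypothesis-22510), line `anchored-peeling`:
# DISTINCT ANCHORS, part 1 — determinants of matrices of PRIVATE monomials

Helper file (`--supports stmt-ValiantsHypothesis-22510`; cell valiant-natproofs, rung V4, 𝒟-side door (c); registered line
`Cruxes/AnchoredDoorHitsLowerPairs/Lines/anchored_peeling.lean` v3; prover seat val-np-p4 gen 16). Two bookkeeping `def`s
(`incCond`, `incExpo`). Closes NO item.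

This is the algebraic core of the DISTINCT-ANCHORS certificate (part 2, `…DistinctAnchors`): the first-order (one anchor per entry)
part of the specialised layout matrix of the anchored door factorises as `P · Q`, where `P` (rows × anchors) and `Q` (anchors × columns)
are INCLUSION MATRICES WEIGHTED BY PRIVATE MONOMIALS: `P[i,k] = [A_k ⊆ u i] · ∏_{b ∈ u i ∖ A_k} φ_{(α_k, b)}` (the twist variables
`φ_{(α_k, ·)}` belong to the anchor `α_k` alone). Such a matrix has NONZERO determinant as soon as its diagonal is admissible
(`A_k ⊆ u k`) and the rows are distinct: in the Leibniz expansion every admissible permutation `τ` contributes `±` a monomial from which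
`τ` can be read off (`u (τ k) = A_k ∪ {b : φ_{(α_k,b)} occurs}`), so no two terms cancel (`det_incMatrix_ne_zero`, from the generic
`det_monomialMatrix_ne_zero`: a matrix `[c k i] · x^{e k i}` with admissible diagonal and «`τ` admissible with the diagonal exponent sum
⇒ `τ = 1`» has the coefficient `1` at the diagonal exponent). The possibly empty row (matched with the empty column) is carried along as
the `0/1` column `[u i = ∅]`.

WHAT THIS IS NOT: nothing on items 22510 / 19717 themselves, on crux stmt-ValiantsHypothesis-14610, or on `VP` versus `VNP`.
-/

set_option linter.dupNamespace false

namespace Summit.ValiantsHypothesis.ValiantsHypothesis.Theorems.BarrierLever.AnchoredPeeling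

open Finset MvPolynomial

noncomputable section

namespace DistinctAnchors

/-! ## 1. Generic: monomial matrices with a unique admissible diagonal -/

/-- A product of «monomial or zero» entries is the monomial of the exponent sum, or zero. -/
theorem prod_ite_monomial {r : ℕ} {κ : Type*} (c : Fin r → Prop) [DecidablePred c] (e : Fin r → (κ →₀ ℕ)) :
    (∏ k, (if c k then monomial (e k) (1 : ℂ) else 0) : MvPolynomial κ ℂ) =
      if (∀ k, c k) then monomial (∑ k, e k) 1 else 0 := by
  classical
  by_cases hall : ∀ k, c k
  · rw [if_pos hall, monomial_sum_one]
    exact Finset.prod_congr rfl (fun k _ => by rw [if_pos (hall k)])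
  · rw [if_neg hall]
    push Not at hall
    obtain ⟨k, hk⟩ := hall
    exact Finset.prod_eq_zero (Finset.mem_univ k) (by rw [if_neg hk])

/-- **Generic non-vanishing.** A square matrix with entries `[c k i] · x^{e k i}` (column `k`, row `i`) whose diagonal is admissible and
such that the identity is the ONLY admissible permutation with the diagonal exponent sum has nonzero determinant (its coefficient at the
diagonal exponent is `1`). -/
theorem det_monomialMatrix_ne_zero {r : ℕ} {κ : Type*} (c : Fin r → Fin r → Prop) [∀ k i, Decidable (c k i)]
    (e : Fin r → Fin r → (κ →₀ ℕ)) (hdiag : ∀ k, c k k)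
    (huniq : ∀ τ : Equiv.Perm (Fin r), (∀ k, c k (τ k)) → ∑ k, e k (τ k) = ∑ k, e k k → τ = 1) :
    (Matrix.of fun i k => if c k i then monomial (e k i) (1 : ℂ) else 0).det ≠ 0 := by
  classical
  have hcoeff : coeff (∑ k, e k k) (Matrix.of fun i k => if c k i then monomial (e k i) (1 : ℂ) else 0).det = 1 := by
    rw [Matrix.det_apply', coeff_sum, Finset.sum_eq_single (1 : Equiv.Perm (Fin r))]
    · simp only [Equiv.Perm.sign_one, Units.val_one, Int.cast_one, one_mul, Matrix.of_apply, Equiv.Perm.coe_one, id_eq]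
      rw [prod_ite_monomial (fun k => c k k) (fun k => e k k), if_pos hdiag, coeff_monomial, if_pos rfl]
    · intro τ _ hτ
      simp only [Matrix.of_apply]
      rw [← map_intCast (C : ℂ →+* MvPolynomial κ ℂ), coeff_C_mul, prod_ite_monomial (fun k => c k (τ k)) (fun k => e k (τ k))]
      by_cases hall : ∀ k, c k (τ k)
      · rw [if_pos hall, coeff_monomial, if_neg (fun heq => hτ (huniq τ hall heq)), mul_zero]
      · rw [if_neg hall, coeff_zero, mul_zero]
    · intro h1
      exact absurd (Finset.mem_univ _) h1
  intro h0
  rw [h0, coeff_zero] at hcoeff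
  exact zero_ne_one hcoeff

/-! ## 2. Inclusion matrices weighted by private monomials -/

variable {h r : ℕ}

/-- Admissibility of the entry (row `i`, anchor column `k`), as a Boolean: for the empty row's column, «row `i` is empty»; otherwise
«the anchor side `g k` is contained in `f i`». -/
def incCond (f g : Fin r → Finset (Fin h)) (k i : Fin r) : Bool :=
  if f k = ∅ then decide (f i = ∅) else decide (g k ⊆ f i)

/-- `incCond` at the empty row's column. -/
theorem incCond_of_empty (f g : Fin r → Finset (Fin h)) (k i : Fin r) (hk : f k = ∅) :
    incCond f g k i = true ↔ f i = ∅ := by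
  rw [incCond, if_pos hk, decide_eq_true_iff]

/-- `incCond` at a nonempty row's column. -/
theorem incCond_of_ne_empty (f g : Fin r → Finset (Fin h)) (k i : Fin r) (hk : f k ≠ ∅) :
    incCond f g k i = true ↔ g k ⊆ f i := by
  rw [incCond, if_neg hk, decide_eq_true_iff]

/-- The private exponent of the entry (row `i`, anchor column `k`): the tail `f i ∖ g k` written in the variables labelled
`emb (lab k, b)`. -/
def incExpo {κ : Type*} (f g : Fin r → Finset (Fin h)) (lab : Fin r → Finset (Fin h) × Finset (Fin h))
    (emb : (Finset (Fin h) × Finset (Fin h)) × Fin h → κ) (k i : Fin r) : κ →₀ ℕ :=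
  if f k = ∅ then 0 else ∑ b ∈ f i \ g k, Finsupp.single (emb (lab k, b)) 1

/-- Evaluating the private exponent at a variable of anchor `k`. -/
theorem incExpo_apply_self {κ : Type*} (f g : Fin r → Finset (Fin h)) (lab : Fin r → Finset (Fin h) × Finset (Fin h))
    (emb : (Finset (Fin h) × Finset (Fin h)) × Fin h → κ) (hemb : Function.Injective emb) (k i : Fin r) (hk : f k ≠ ∅)
    (b : Fin h) : incExpo f g lab emb k i (emb (lab k, b)) = if b ∈ f i \ g k then 1 else 0 := by
  classical
  rw [incExpo, if_neg hk, Finsupp.finsetSum_apply]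
  simp only [Finsupp.single_apply]
  have key : ∀ b' : Fin h, (emb (lab k, b') = emb (lab k, b)) ↔ b' = b := fun b' =>
    ⟨fun hh => by have := hemb hh; simp only [Prod.mk.injEq] at this; exact this.2, fun hh => by rw [hh]⟩
  simp only [key]
  rw [Finset.sum_ite_eq']

/-- Evaluating the private exponent of anchor `k'` at a variable of a DIFFERENT label vanishes. -/
theorem incExpo_apply_other {κ : Type*} (f g : Fin r → Finset (Fin h)) (lab : Fin r → Finset (Fin h) × Finset (Fin h))
    (emb : (Finset (Fin h) × Finset (Fin h)) × Fin h → κ) (hemb : Function.Injective emb) (k k' i : Fin r)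
    (hne : lab k' ≠ lab k) (b : Fin h) : incExpo f g lab emb k' i (emb (lab k, b)) = 0 := by
  classical
  unfold incExpo
  split_ifs
  · rfl
  · rw [Finsupp.finsetSum_apply]
    refine Finset.sum_eq_zero (fun b' _ => ?_)
    rw [Finsupp.single_apply, if_neg]
    intro hh
    have := hemb hh
    simp only [Prod.mk.injEq] at this
    exact hne this.1

/-- **Inclusion matrices with private monomials are nonsingular.** Rows `f i` distinct, anchor sides `g k ⊆ f k` for the nonempty rows,
labels `lab k` distinct on the nonempty rows, `emb` injective: then `det [ [incCond] · x^{incExpo} ] ≠ 0`. -/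
theorem det_incMatrix_ne_zero {κ : Type*} (f g : Fin r → Finset (Fin h)) (hf : Function.Injective f)
    (hg : ∀ k, f k ≠ ∅ → g k ⊆ f k) (lab : Fin r → Finset (Fin h) × Finset (Fin h))
    (hlab : ∀ k k', f k ≠ ∅ → f k' ≠ ∅ → lab k = lab k' → k = k')
    (emb : (Finset (Fin h) × Finset (Fin h)) × Fin h → κ) (hemb : Function.Injective emb) :
    (Matrix.of fun i k => if incCond f g k i then monomial (incExpo f g lab emb k i) (1 : ℂ) else 0).det ≠ 0 := by
  classical
  refine det_monomialMatrix_ne_zero (fun k i => incCond f g k i = true) (incExpo f g lab emb) (fun k => ?_)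
    (fun τ hc heq => ?_)
  · by_cases hk : f k = ∅
    · exact (incCond_of_empty f g k k hk).mpr hk
    · exact (incCond_of_ne_empty f g k k hk).mpr (hg k hk)
  · ext1 k
    rw [Equiv.Perm.coe_one, id_eq]
    apply hf
    by_cases hk : f k = ∅
    · have := (incCond_of_empty f g k (τ k) hk).mp (hc k)
      rw [this, hk]
    · have hsub : g k ⊆ f (τ k) := (incCond_of_ne_empty f g k (τ k) hk).mp (hc k)
      have hval : ∀ b : Fin h, (b ∈ f (τ k) \ g k) ↔ (b ∈ f k \ g k) := by
        intro b
        have h1 := congrArg (fun v : κ →₀ ℕ => v (emb (lab k, b))) heq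
        simp only [Finsupp.coe_finsetSum, Finset.sum_apply] at h1
        rw [Finset.sum_eq_single k (fun k' _ hk' => ?_) (fun hh => absurd (Finset.mem_univ _) hh),
          Finset.sum_eq_single k (fun k' _ hk' => ?_) (fun hh => absurd (Finset.mem_univ _) hh),
          incExpo_apply_self f g lab emb hemb k (τ k) hk, incExpo_apply_self f g lab emb hemb k k hk] at h1
        · constructor
          · intro hb; by_contra hb'; rw [if_pos hb, if_neg hb'] at h1; exact one_ne_zero h1
          · intro hb; by_contra hb'; rw [if_neg hb', if_pos hb] at h1; exact zero_ne_one h1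
        · by_cases hk'e : f k' = ∅
          · rw [incExpo, if_pos hk'e, Finsupp.zero_apply]
          · exact incExpo_apply_other f g lab emb hemb k k' k' (fun hh => hk' (hlab k' k hk'e hk hh)) b
        · by_cases hk'e : f k' = ∅
          · rw [incExpo, if_pos hk'e, Finsupp.zero_apply]
          · exact incExpo_apply_other f g lab emb hemb k k' (τ k') (fun hh => hk' (hlab k' k hk'e hk hh)) b
      ext b
      by_cases hb : b ∈ g k
      · exact ⟨fun _ => hg k hk hb, fun _ => hsub hb⟩
      · have := hval b
        simp only [Finset.mem_sdiff, hb, not_false_eq_true, and_true] at this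
        exact this

end DistinctAnchors

end

end Summit.ValiantsHypothesis.ValiantsHypothesis.Theorems.BarrierLever.AnchoredPeeling
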